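import Literature.MathematicalPhysics.QuantumFieldTheory.Balaban1983to89.Node00.BackgroundCurrentCompare
import Literature.MathematicalPhysics.QuantumFieldTheory.Balaban1983to89.B11Thm1

/-!
# `Balaban1983to89.B11Thm1CarrierT` — [Balaban1985Variational] Theorem 1 p. 279: its carrier `B11.VarProblem` READ AT NODE 00's OBJECTS in the
# no-holes case `Ω_j = T` (the variational problem (5)–(6) of NODE 00's Stage ₈a, `Node00/BackgroundActionOfRecord` + `BackgroundCurrentShape`), and the
# three clauses of Theorem 1 — existence (8), uniqueness in (6), regularity (9)–(10) — UNFOLDED in that currency: what the Theorem-1 slot `t1` of a B11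
# pin `Z11OfRecord θ P` (NODE 00 Stage 3′(Z)) says about Bałaban's minimisers `U_k(V)`, and how it meets the GAPS rows G₈a-1 ∕ 2 ∕ 3

T. Bałaban, *The variational problem and background fields in renormalization group method for lattice gauge theories*, Commun. Math. Phys. **102**
(1985) 277–309, doi:10.1007/bf01229381 [Balaban1985Variational] (cell paper B11), Theorem 1 p. 279 with the spaces (2), (3), (6), (8) p. 278 and the
functional (5); [Balaban1987RG1] («[I]») (0.21) p. 256, (1.1)–(1.2) p. 260 for NODE 00's letters.  Seat `pub-ymgap-dag-n07-a` (gen 2; YM-PLAN Track A,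
HUMAN RULING D-0062, KNIT-BY-NAME seat of node N07; this is the seat's INTENT-2 «the pin socket at objects», companion of `B11LeafUnpinnedRecord`
(N07 is undetermined over `IsRecordOfRecord₅C∕₈C` until the [B11] group is pinned)).  OFFERED TO NODE 00's Stage 3′(Z) (node00-def
`STAGE5-SCOPING-g28.md` table row «`Z P` [B11] … Stage 3′») as the Theorem-1 FAMILY of the pin; NOT a definition of record until NODE 00 adopts it.

WHAT IS DEFINED (two definitions, no instance, no notation):
* `RegCarrierT F N K` — the RESIDUAL of this socket: the cube class of Sect. F of [Balaban1984PropagatorsII] on the torus and the four local-gauge norm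
  functionals of (9)–(10) (`|A|`, `|∇^ηA|`, `‖A‖_{1,β}`, `max{|∂^{η*}∂^ηA|, |Δ^ηA|}` for `U^{u⁻¹} = e^{iηA}` on a neighbourhood of `□`) as DATA — the lattice
  local-axial-gauge norm vocabulary shared with [Balaban1985RegularSpaces] Prop. 6 (1.135)–(1.136) is not yet typed at objects (its axial log on the torus
  is `B10Eq27TorusAxialLog.B27T`); nothing here reads these fields except the regularity clause.
* `varProblemT F N K k R : B11.VarProblem` — Theorem 1's carrier for the geometric datum «finest torus of the `K`-th approximation, `k` steps,
  `Ω_0 = … = Ω_k = T` (so `𝔅_k = Λ_k = T^{(k)}`), `η = L^{−k}`»: `Cfg := GaugeField (F.P K) 0 (SU N)`, `Bdry := GaugeField (F.P K) k (SU N)`,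
  `InU ε₀ U :=` [B11] (2) at `Ω_j = T` = n01-b's `Node00.InUkClassB11` BY NAME, `InB V U :=` (3) `Ū^k = V` with NODE 00's averaging of record
  `Averaging.iter (Node00.avOfRecord F N K) k`, `Reg7 ε₁ V :=` (7) `PlaqSmall ε₁ V`, `OnMinimalOrbit e V U :=` «U minimises (5) = `wilsonAction4` on
  `𝔘_k(e) ∩ 𝔅_k(V)` and lies in it» = the tree's `IsBackground` over the class `{U | InUkClassB11 … e U}` BY NAME, `UniqueCriticalOrbit ε₀ V U :=` the
  DECLARED READING D-n07a-1 below; the regularity fields are `R`'s.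

DECLARED READINGS (cell DIVERGENCE style; each weaker-than-print item is a RESTRICT∕ADMIT species candidate for the chair, not a ruling):
* D-n07a-1 «critical ↦ minimal» in the uniqueness clause: print «This orbit is a unique critical orbit in the space (6)»; typed: `U ∈ (6)`, `Ū^k = V`, and
  EVERY MINIMISER of (5) over (6) lies on the orbit of `U` under the residual group of level `k` (`B12GaugeOrbits021.OrbitRel k`, [I] p. 257 «u = 1 on
  T⁽ᵏ⁾» = print's group (4)).  WEAKER than print (minimisers over the open set (6) are critical); it is exactly the currency of ₈a's consumers
  (`Node00.UniqueUkOrbit`, `Node00.HOrbit`: uniqueness among minimisers).  Criticality on `SU(N)^{bonds}` is not typed here.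
* D-n07a-2 «minimal orbit in the space (8)» ↦ `IsBackground` over the (2)-class at radius `B₃ε₁`: the minimum of (5) over `𝔘_k(B₃ε₁) ∩ 𝔅_k(V)` is ATTAINED
  at `U`, which lies in that space (print's sentence read literally).

INTERFACE FINDING F7 (for def-B ∕ node00-def ∕ dag-n09; located, not adjudicated): ₈a's solvability `Node00.UkExists F N K k ε V` minimises over the
PLAQUETTE-ONLY class `bgReg` (its D-defB-1), print's (8) over the (2)-class `InUkClassB11 ⊆ bgReg` (`Node00.InUkClassB11.mem_bgReg`).  A minimiser over the
larger class lying in the smaller one is a minimiser over the smaller one (`isBackground_of_subset_of_mem`), so ₈a's G₈a-1 ∧ G₈a-3 give the pin's (8)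
(`exists8_of_ukExists_of_ukInSpaceB11`); the converse — from Theorem 1's (8) at the pin to `UkExists` — is NOT formal (a minimiser over `𝔘_k` need not
minimise over `bgReg`) and is recorded as the a-priori item «minimisers of (5) over `bgReg(ε) ∩ 𝔅_k(V)`, `V` with (7), lie in `𝔘_k(ε)`» or as a re-reading of
(0.21) over the (2)-class (print [I] (1.2) defines `U_k(ε₀)` WITH the current clause).

WHAT IS PROVED (unfoldings and one-line consequences; 0 sorry): `inU_iff`, `inB_iff`, `reg7_iff`, `onMinimalOrbit_iff`, `uniqueCriticalOrbit_iff` (`Iff.rfl`);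
`exists8_iff` ((8) at objects ⇔ a minimiser of (5) over `𝔘_k(B₃ε₁) ∩ 𝔅_k(V)` exists), `unique6_iff`, `reg910_iff`; `mem_bgReg_of_onMinimalOrbit`,
`inUkClass_of_onMinimalOrbit` (a minimal configuration lies in ₈a's class and in [I] (1.2)'s full space `U_k(2e)` — G₈a-3's content FOR THE PIN'S minimiser,
by n01-b's `inUkClass_of_inUkClassB11`); `onMinimalOrbit_gaugeAct` ∕ `onMinimalOrbit_iff_of_orbitRel` («minimal ORBIT» is honest: minimality is carried
along the residual group, `B12GaugeOrbits021.isBackground_gaugeAct` + `Node00.inUkClassB11_gaugeAct_iff`); `isBackground_of_subset_of_mem`, `exists8_of_ukExists_of_ukInSpaceB11` (F7's formal direction);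
**`objects_of_thm1Printed`**: `B11.Thm1Printed` over ANY family of these carriers (levels `k i`, approximations `K i`) UNFOLDS to «constants `a₀ a₁ B₃`
before the member; for `0 < ε₁ ≤ a₁` and every `V` with `PlaqSmall ε₁ V`: a minimiser of `wilsonAction4` over `𝔘_{k}(B₃ε₁) ∩ {Ū^k = V}` exists, and for
`B₃ε₁ ≤ ε₀ ≤ a₀` every minimiser over `𝔘_k(ε₀) ∩ {Ū^k = V}` is a residual-gauge transform of it» — the object-level sentence a discharge of N07's `t1`
at such a pin certifies; `reg7_one` ((7) is met by the flat datum: the slot's hypothesis is not vacuous), `nonempty_regCarrierT`.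

HONEST FRAMING: two definitions (a residual data structure and a carrier READ at NODE 00's objects) + kernel unfoldings; NOTHING of Bałaban's is asserted
— Theorem 1 at these objects (GAPS G₈a-1∕2∕3 + (9)–(10)) is proved nowhere in the tree; no object of record is touched; count-neutral (N07 NOT discharged);
one finite four-torus programme at fixed `ε`; nothing continuum ∕ ℝ⁴ ∕ OS ∕ mass-gap ∕ Clay.
-/

noncomputable section

namespace Literature.MathematicalPhysics.QuantumFieldTheory.Balaban1983to89.B11Thm1CarrierT

open T4Continuum (T4Family)
open B12GaugeOrbits021 (OrbitRel)
open Node00 (SU avOfRecord bgReg InUkClassB11 InUkClass UkExists UkInSpaceB11 Uk)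
open B11Thm1 (Exists8 Unique6 Reg910)

variable (F : T4Family) (N : ℕ) [NeZero N]

/-! ## §1. The residual regularity data and the Theorem-1 carrier at NODE 00's objects -/

/-- **RESIDUAL of the socket — the cube class and the local-gauge norms of (9)–(10)** on the finest torus of the `K`-th approximation, as DATA: the cubes
`□` «in the class described above» (Sect. F of [Balaban1984PropagatorsII]) with scale `j` (`scale`) and size parameter `M` (`sizeM`, `□` of size `2ML^jη`);
`Gauged U □` = «there exists a gauge transformation u defined on a neighborhood of □ and such that on □, U^{u⁻¹} = e^{iηA}»; the sup-norms on `□` of that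
`A`: `normA = |A|`, `normGradA = |∇^ηA|`, `holderA · · β = ‖A‖_{1,β}`, `normLapA = max{|∂^{η*}∂^ηA|, |Δ^ηA|}`.  To be PINNED by the lattice local-axial-gauge
vocabulary (torus axial log `B10Eq27TorusAxialLog.B27T`); read by the regularity clause only. [cite: Balaban1985Variational, (9)–(10) p.279] -/
structure RegCarrierT (K : ℕ) where
  /-- the class of cubes `□ ⊂ T` -/
  Cube : Type
  /-- the scale `j` of a cube -/
  scale : Cube → ℕ
  /-- the size parameter `M` of a cube of size `2ML^jη` -/
  sizeM : Cube → ℝ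
  /-- existence of the local gauge `u` with `U^{u⁻¹} = e^{iηA}` on a neighbourhood of `□` -/
  Gauged : GaugeField (F.P K) 0 (SU N) → Cube → Prop
  /-- `sup_□ |A|` -/
  normA : GaugeField (F.P K) 0 (SU N) → Cube → ℝ
  /-- `sup_□ |∇^η A|` -/
  normGradA : GaugeField (F.P K) 0 (SU N) → Cube → ℝ
  /-- `‖A‖_{1,β}` on `□` -/
  holderA : GaugeField (F.P K) 0 (SU N) → Cube → ℝ → ℝ
  /-- `max{sup_□ |∂^{η*}∂^η A|, sup_□ |Δ^η A|}` -/
  normLapA : GaugeField (F.P K) 0 (SU N) → Cube → ℝ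

/-- **[B11] Theorem 1's carrier READ AT NODE 00's OBJECTS, no-holes case** (`Ω_0 = … = Ω_k = T`, `𝔅_k = Λ_k = T^{(k)}`, `η = L^{−k}`): configurations `U`
on the finest torus of the `K`-th approximation, boundary data `V` on `T^{(k)}`; (2) `InU ε₀ U := Node00.InUkClassB11 F N K k ε₀ U`; (3) `InB V U := Ū^k = V`
(averaging of record); (7) `Reg7 ε₁ V := PlaqSmall ε₁ V`; «minimal orbit of (5) in `𝔘_k(e) ∩ 𝔅_k(V)`» `:= IsBackground (avOfRecord F N K) {InUkClassB11 e} k V U`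
(reading D-n07a-2); «unique critical orbit in (6)» `:=` reading D-n07a-1 (every minimiser over (6) is a level-`k` residual-gauge transform of `U`); (9)–(10)
data from `R`. [cite: Balaban1985Variational, (2)–(8) p.278 and Thm 1 p.279] -/
def varProblemT (K k : ℕ) (R : RegCarrierT F N K) : B11.VarProblem where
  Cfg := GaugeField (F.P K) 0 (SU N)
  Bdry := GaugeField (F.P K) k (SU N)
  Cube := R.Cube
  scale := R.scale
  sizeM := R.sizeM
  eta := (F.P K).eta k
  L := F.L
  InU := fun ε₀ U => InUkClassB11 F N K k ε₀ U
  InB := fun V U => Averaging.iter (avOfRecord F N K) k U = V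
  Reg7 := fun ε₁ V => PlaqSmall ε₁ V
  OnMinimalOrbit := fun e V U => IsBackground (avOfRecord F N K) {U | InUkClassB11 F N K k e U} k V U
  UniqueCriticalOrbit := fun ε₀ V U =>
    InUkClassB11 F N K k ε₀ U ∧ Averaging.iter (avOfRecord F N K) k U = V ∧
      ∀ U' : GaugeField (F.P K) 0 (SU N), IsBackground (avOfRecord F N K) {U | InUkClassB11 F N K k ε₀ U} k V U' → OrbitRel k U U'
  Gauged := R.Gauged
  normA := R.normA
  normGradA := R.normGradA
  holderA := R.holderA
  normLapA := R.normLapA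

variable {F N}

/-! ## §2. Unfoldings (`Iff.rfl`) -/

section Unfold

variable {K k : ℕ} (R : RegCarrierT F N K)

/-- (2) at the carrier IS n01-b's `InUkClassB11`. [cite: Balaban1985Variational, (2) p.278] -/
theorem inU_iff (ε₀ : ℝ) (U : GaugeField (F.P K) 0 (SU N)) : (varProblemT F N K k R).InU ε₀ U ↔ InUkClassB11 F N K k ε₀ U := Iff.rfl

/-- (3) at the carrier IS `Ū^k = V` for the averaging of record. [cite: Balaban1985Variational, (3) p.278] -/
theorem inB_iff (V : GaugeField (F.P K) k (SU N)) (U : GaugeField (F.P K) 0 (SU N)) :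
    (varProblemT F N K k R).InB V U ↔ Averaging.iter (avOfRecord F N K) k U = V := Iff.rfl

/-- (7) at the carrier IS `PlaqSmall ε₁ V`. [cite: Balaban1985Variational, (7) p.278] -/
theorem reg7_iff (ε₁ : ℝ) (V : GaugeField (F.P K) k (SU N)) : (varProblemT F N K k R).Reg7 ε₁ V ↔ PlaqSmall ε₁ V := Iff.rfl

/-- «U lies on a minimal orbit of (5) in `𝔘_k(e) ∩ 𝔅_k(V)`» IS `IsBackground` over the (2)-class (reading D-n07a-2). [cite: Balaban1985Variational, (5)–(6), (8) p.278] -/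
theorem onMinimalOrbit_iff (e : ℝ) (V : GaugeField (F.P K) k (SU N)) (U : GaugeField (F.P K) 0 (SU N)) :
    (varProblemT F N K k R).OnMinimalOrbit e V U ↔ IsBackground (avOfRecord F N K) {U | InUkClassB11 F N K k e U} k V U := Iff.rfl

/-- «The orbit of U is the unique critical orbit in (6)» in the declared reading D-n07a-1. [cite: Balaban1985Variational, Thm 1 p.279 («unique critical orbit in the space (6)»)] -/
theorem uniqueCriticalOrbit_iff (ε₀ : ℝ) (V : GaugeField (F.P K) k (SU N)) (U : GaugeField (F.P K) 0 (SU N)) :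
    (varProblemT F N K k R).UniqueCriticalOrbit ε₀ V U ↔
      InUkClassB11 F N K k ε₀ U ∧ Averaging.iter (avOfRecord F N K) k U = V ∧
        ∀ U' : GaugeField (F.P K) 0 (SU N), IsBackground (avOfRecord F N K) {U | InUkClassB11 F N K k ε₀ U} k V U' → OrbitRel k U U' :=
  Iff.rfl

/-- **(8) AT OBJECTS**: `B11Thm1.Exists8` at the carrier ⇔ a minimiser of `wilsonAction4` over `𝔘_k(B₃ε₁) ∩ {Ū^k = V}` exists (its first two conjuncts are the
minimiser's own membership clauses). [cite: Balaban1985Variational, Thm 1 (8) p.279] -/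
theorem exists8_iff (B₃ ε₁ : ℝ) (V : GaugeField (F.P K) k (SU N)) :
    Exists8 (varProblemT F N K k R) B₃ ε₁ V ↔
      ∃ U : GaugeField (F.P K) 0 (SU N), IsBackground (avOfRecord F N K) {U | InUkClassB11 F N K k (B₃ * ε₁) U} k V U :=
  ⟨fun ⟨U, _, _, hU⟩ => ⟨U, hU⟩, fun ⟨U, hU⟩ => ⟨U, hU.2.1, hU.1, hU⟩⟩

/-- **Uniqueness AT OBJECTS** (reading D-n07a-1): `B11Thm1.Unique6` at the carrier, unfolded. [cite: Balaban1985Variational, Thm 1 p.279 («unique critical orbit in the space (6) if B₃ε₁ ≤ ε₀ and ε₀ ≤ a₀»)] -/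
theorem unique6_iff (a₀ B₃ ε₁ : ℝ) (V : GaugeField (F.P K) k (SU N)) :
    Unique6 (varProblemT F N K k R) a₀ B₃ ε₁ V ↔
      ∀ ε₀ : ℝ, B₃ * ε₁ ≤ ε₀ → ε₀ ≤ a₀ → ∀ U : GaugeField (F.P K) 0 (SU N),
        IsBackground (avOfRecord F N K) {U | InUkClassB11 F N K k (B₃ * ε₁) U} k V U →
          InUkClassB11 F N K k ε₀ U ∧ Averaging.iter (avOfRecord F N K) k U = V ∧
            ∀ U' : GaugeField (F.P K) 0 (SU N), IsBackground (avOfRecord F N K) {U | InUkClassB11 F N K k ε₀ U} k V U' → OrbitRel k U U' :=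
  Iff.rfl

/-- **(9)–(10) AT OBJECTS**: `B11Thm1.Reg910` at the carrier reads the residual data `R` for every minimiser and every cube with `sizeM □ ≤ M`.
[cite: Balaban1985Variational, Thm 1 (9)–(10) p.279] -/
theorem reg910_iff (B₃ B₄ ε₁ M : ℝ) (V : GaugeField (F.P K) k (SU N)) :
    Reg910 (varProblemT F N K k R) B₃ B₄ ε₁ M V ↔
      ∀ U : GaugeField (F.P K) 0 (SU N), IsBackground (avOfRecord F N K) {U | InUkClassB11 F N K k (B₃ * ε₁) U} k V U →
        ∀ c : R.Cube, R.sizeM c ≤ M → B11.Regularity (varProblemT F N K k R) B₃ B₄ ε₁ U c :=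
  Iff.rfl

end Unfold

/-! ## §3. What a minimal configuration at the carrier carries; the link with ₈a (finding F7) -/

section Links

variable {K k : ℕ} (R : RegCarrierT F N K)

/-- A minimal configuration (reading D-n07a-2) lies in [B11] (2)'s space at its radius. [cite: Balaban1985Variational, (8) p.279] -/
theorem inUkClassB11_of_onMinimalOrbit {e : ℝ} {V : GaugeField (F.P K) k (SU N)} {U : GaugeField (F.P K) 0 (SU N)}
    (h : (varProblemT F N K k R).OnMinimalOrbit e V U) : InUkClassB11 F N K k e U :=
  h.2.1

/-- … hence in ₈a's plaquette class `bgReg F N K k e` (n01-b's `InUkClassB11.mem_bgReg`). [cite: Balaban1987RG1, (1.2) p.260] -/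
theorem mem_bgReg_of_onMinimalOrbit {e : ℝ} {V : GaugeField (F.P K) k (SU N)} {U : GaugeField (F.P K) 0 (SU N)}
    (h : (varProblemT F N K k R).OnMinimalOrbit e V U) : U ∈ bgReg F N K k e :=
  (inUkClassB11_of_onMinimalOrbit R h).mem_bgReg

/-- … and in [I] (1.2)'s FULL space `U_k(2e)` (current clause with the constant doubled: n01-b's `inUkClass_of_inUkClassB11`, `e ≥ 0`) — the content of
GAPS row G₈a-3 FOR THE PIN's minimal configurations. [cite: Balaban1987RG1, (1.2) p.260 («implied by the condition on V … see Theorem 1 [15]»)] -/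
theorem inUkClass_of_onMinimalOrbit {e : ℝ} (he : 0 ≤ e) {V : GaugeField (F.P K) k (SU N)} {U : GaugeField (F.P K) 0 (SU N)}
    (h : (varProblemT F N K k R).OnMinimalOrbit e V U) : InUkClass F N K k (2 * e) U :=
  Node00.inUkClass_of_inUkClassB11 F N he (inUkClassB11_of_onMinimalOrbit R h)

/-- Its averaging is `V` and it minimises (5) over the space. [cite: Balaban1985Variational, (3), (5), (8) p.278] -/
theorem iter_eq_and_le_of_onMinimalOrbit {e : ℝ} {V : GaugeField (F.P K) k (SU N)} {U : GaugeField (F.P K) 0 (SU N)}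
    (h : (varProblemT F N K k R).OnMinimalOrbit e V U) :
    Averaging.iter (avOfRecord F N K) k U = V ∧
      ∀ U' : GaugeField (F.P K) 0 (SU N), InUkClassB11 F N K k e U' → Averaging.iter (avOfRecord F N K) k U' = V →
        wilsonAction4 U ≤ wilsonAction4 U' :=
  ⟨h.1, h.2.2⟩

/-- **«minimal ORBIT» is honest at the carrier**: the minimising property over `𝔘_k(e) ∩ 𝔅_k(V)` is carried along the residual gauge group of level
`k` — [B11] p. 278 «the spaces … are invariant» (n01-b's `Node00.inUkClassB11_gaugeAct_iff`) + dag-p07's `B12GaugeOrbits021.isBackground_gaugeAct`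
(`Ū^k(U^u) = Ū^k(U)` for `u = 1` on `T⁽ᵏ⁾`, `A(U^u) = A(U)`), in the standing range `k ≤ m + K`. [cite: Balaban1985Variational, (4)–(6) p.278; Balaban1987RG1, (0.21) p.256] -/
theorem onMinimalOrbit_gaugeAct {e : ℝ} {V : GaugeField (F.P K) k (SU N)} {U : GaugeField (F.P K) 0 (SU N)} (hk : k ≤ (F.P K).m + (F.P K).K)
    (h : (varProblemT F N K k R).OnMinimalOrbit e V U) {u : GaugeTransf (F.P K) 0 (SU N)} (hu : B12GaugeOrbits021.IsResidual k u) :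
    (varProblemT F N K k R).OnMinimalOrbit e V (GaugeField.gaugeAct u U) :=
  B12GaugeOrbits021.isBackground_gaugeAct hk (fun u' _ U' hU' => (Node00.inUkClassB11_gaugeAct_iff u' U').2 hU') h hu

/-- The minimising property at the carrier is a property of the residual ORBIT (`k ≤ m + K`). [cite: Balaban1985Variational, (4)–(6) p.278; Balaban1987RG1, (0.21) p.256] -/
theorem onMinimalOrbit_iff_of_orbitRel {e : ℝ} (V : GaugeField (F.P K) k (SU N)) {U U' : GaugeField (F.P K) 0 (SU N)}
    (hk : k ≤ (F.P K).m + (F.P K).K) (hUU' : OrbitRel k U U') :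
    (varProblemT F N K k R).OnMinimalOrbit e V U ↔ (varProblemT F N K k R).OnMinimalOrbit e V U' :=
  B12GaugeOrbits021.isBackground_iff_of_orbitRel hk (fun u' _ U'' hU'' => (Node00.inUkClassB11_gaugeAct_iff u' U'').2 hU'') V hUU'

/-- **A minimiser over a larger class that lies in a smaller class minimises over the smaller class** (the formal half of finding F7).
[cite: Balaban1987RG1, (0.21) p.256 (bookkeeping)] -/
theorem isBackground_of_subset_of_mem {P : Params} {G : Type*} [GaugeGroup G] {av : ∀ j, Averaging P j G} {reg reg' : Set (GaugeField P 0 G)} {j : ℕ}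
    {V : GaugeField P j G} {U : GaugeField P 0 G} (h : IsBackground av reg j V U) (hsub : reg' ⊆ reg) (hmem : U ∈ reg') :
    IsBackground av reg' j V U :=
  ⟨h.1, hmem, fun U' hU' hV' => h.2.2 U' (hsub hU') hV'⟩

/-- **F7, formal direction: ₈a's G₈a-1 ∧ G₈a-3 give the pin's (8)** — if the level-`k` problem over `bgReg(ε)` is solvable at `V` (`UkExists`) and ₈a's
minimiser of record lies in (2)'s space with constant `ε` (`UkInSpaceB11 K k ε ε`), then `U_k(V)` of record is a minimal configuration of the carrier at
radius `ε`. [cite: Balaban1985Variational, Thm 1 (8) p.279; Balaban1987RG1, (1.1)–(1.2) p.260] -/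
theorem onMinimalOrbit_Uk_of_ukInSpaceB11 {ε : ℝ} (hG3 : UkInSpaceB11 F N K k ε ε) {V : GaugeField (F.P K) k (SU N)} (hG1 : UkExists F N K k ε V) :
    (varProblemT F N K k R).OnMinimalOrbit ε V (Uk F N K k ε V) :=
  isBackground_of_subset_of_mem (Node00.isBackground_Uk hG1) (fun _ hU => Node00.InUkClassB11.mem_bgReg hU) (hG3 V hG1)

/-- F7 packaged as (8): `UkExists` at `B₃ε₁` ∧ `UkInSpaceB11 K k (B₃ε₁) (B₃ε₁)` ⇒ `Exists8` at the carrier. [cite: Balaban1985Variational, Thm 1 (8) p.279] -/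
theorem exists8_of_ukExists_of_ukInSpaceB11 {B₃ ε₁ : ℝ} (hG3 : UkInSpaceB11 F N K k (B₃ * ε₁) (B₃ * ε₁)) {V : GaugeField (F.P K) k (SU N)}
    (hG1 : UkExists F N K k (B₃ * ε₁) V) : Exists8 (varProblemT F N K k R) B₃ ε₁ V :=
  (exists8_iff R B₃ ε₁ V).2 ⟨_, onMinimalOrbit_Uk_of_ukInSpaceB11 R hG3 hG1⟩

end Links

/-! ## §4. Theorem 1 over a family of these carriers, unfolded at the objects -/

/-- **THEOREM 1 AT NODE 00's OBJECTS, UNFOLDED** — what a discharge of the `t1` slot of a B11 pin built from these carriers certifies: for any index `I`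
(members = approximations `K i`, levels `k i`, residual regularity data `R i`), `B11.Thm1Printed` over the family gives constants `a₀, a₁, B₃` with
`B₃a₁ ≤ a₀`, chosen BEFORE the member, such that for `0 < ε₁ ≤ a₁` and every boundary datum `V` on `T^{(k)}` with `|V(∂p) − 1| < ε₁`: (8) a minimiser of
`wilsonAction4` over `𝔘_k(B₃ε₁) ∩ {Ū^k = V}` EXISTS; and for `B₃ε₁ ≤ ε₀ ≤ a₀` it lies in `𝔘_k(ε₀)` and every minimiser over `𝔘_k(ε₀) ∩ {Ū^k = V}` is a level-`k`
residual-gauge transform of it (reading D-n07a-1).  The regularity clause is dropped here (it reads `R`). [cite: Balaban1985Variational, Thm 1 p.279] -/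
theorem objects_of_thm1Printed {I : Type} (Kof kof : I → ℕ) (R : ∀ i, RegCarrierT F N (Kof i))
    (h : B11.Thm1Printed (fun i => varProblemT F N (Kof i) (kof i) (R i))) :
    ∃ a₀ a₁ B₃ : ℝ, 0 < a₀ ∧ 0 < a₁ ∧ 0 < B₃ ∧ B₃ * a₁ ≤ a₀ ∧
      ∀ i : I, ∀ ε₁ : ℝ, 0 < ε₁ → ε₁ ≤ a₁ → ∀ V : GaugeField (F.P (Kof i)) (kof i) (SU N), PlaqSmall ε₁ V →
        (∃ U : GaugeField (F.P (Kof i)) 0 (SU N),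
            IsBackground (avOfRecord F N (Kof i)) {U | InUkClassB11 F N (Kof i) (kof i) (B₃ * ε₁) U} (kof i) V U) ∧
        (∀ ε₀ : ℝ, B₃ * ε₁ ≤ ε₀ → ε₀ ≤ a₀ → ∀ U U' : GaugeField (F.P (Kof i)) 0 (SU N),
            IsBackground (avOfRecord F N (Kof i)) {U | InUkClassB11 F N (Kof i) (kof i) (B₃ * ε₁) U} (kof i) V U →
            IsBackground (avOfRecord F N (Kof i)) {U | InUkClassB11 F N (Kof i) (kof i) ε₀ U} (kof i) V U' →
              InUkClassB11 F N (Kof i) (kof i) ε₀ U ∧ OrbitRel (kof i) U U') := by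
  obtain ⟨a₀, a₁, B₃, B₄, Mfun, ha₀, ha₁, hB₃, -, hle, -, H⟩ := h
  refine ⟨a₀, a₁, B₃, ha₀, ha₁, hB₃, hle, fun i ε₁ hε₁ hε₁a V hV => ?_⟩
  obtain ⟨hex, huniq, -⟩ := H i ε₁ hε₁ hε₁a V hV
  refine ⟨(exists8_iff (R i) B₃ ε₁ V).1 hex, fun ε₀ hlo hhi U U' hU hU' => ?_⟩
  have hu := huniq ε₀ hlo hhi U hU
  exact ⟨hu.1, hu.2.2 U' hU'⟩

/-- Conversely-shaped bookkeeping: Theorem 1 over the family IS one block of constants with `B11Thm1.Thm1At` at every member (`B11Thm1.thm1Printed_iff` by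
name) — the form in which a level-by-level induction (Sect. A) states it. [cite: Balaban1985Variational, Thm 1 p.279 («will be proved by induction with respect to k»)] -/
theorem thm1Printed_iff_thm1At {I : Type} (Kof kof : I → ℕ) (R : ∀ i, RegCarrierT F N (Kof i)) :
    B11.Thm1Printed (fun i => varProblemT F N (Kof i) (kof i) (R i)) ↔
      ∃ C : B11Thm1.Consts, ∀ i, B11Thm1.Thm1At C (varProblemT F N (Kof i) (kof i) (R i)) :=
  B11Thm1.thm1Printed_iff _

/-! ## §5. Non-vacuity of the slot's hypothesis and of the residual data type -/

/-- **(7) is met by the flat boundary datum** for every `ε₁ > 0`: the hypothesis of the Theorem-1 slot at the carrier is not vacuous (`dist1 1 = 0`).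
[cite: Balaban1985Variational, (7) p.278] -/
theorem reg7_one {K k : ℕ} (R : RegCarrierT F N K) {ε₁ : ℝ} (hε₁ : 0 < ε₁) :
    (varProblemT F N K k R).Reg7 ε₁ (1 : GaugeField (F.P K) k (SU N)) := by
  intro p
  have h1 : GaugeField.plaqHol (1 : GaugeField (F.P K) k (SU N)) p = 1 := by
    simp [GaugeField.plaqHol, show ∀ b : PBond (F.P K) k, (1 : GaugeField (F.P K) k (SU N)) b = 1 from fun _ => rfl]
  rw [h1, GaugeGroup.dist1_one]
  exact hε₁

omit [NeZero N] in
/-- The residual data type is inhabited (DEGENERATE inhabitant: no cubes; NOT an object of record — with it the regularity clause is vacuous, which is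
exactly why `RegCarrierT` must be pinned by genuine cube data before a discharge means (9)–(10)). [cite: Balaban1985Variational, (9)–(10) p.279 (bookkeeping)] -/
theorem nonempty_regCarrierT (K : ℕ) : Nonempty (RegCarrierT F N K) :=
  ⟨⟨PEmpty, fun c => c.elim, fun c => c.elim, fun _ _ => True, fun _ _ => 0, fun _ _ => 0, fun _ _ _ => 0, fun _ _ => 0⟩⟩

end Literature.MathematicalPhysics.QuantumFieldTheory.Balaban1983to89.B11Thm1CarrierT
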